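import Summits.FinalStateConjecture.FinalStateConjecture.Theorems.EIHFluxBalanceInertialRecessionStubWeightedRatesNecessity

/-!
# Route EIHFluxBalance — `InertialRecession`, line `sublinear-is-free-clean-window-charges`,
# stub `stub_weightedRates`: quasi-stationarity FORCES the weighted 4-velocity rate (one hole)

Helper file of the worker on `stub_weightedRates` (crux `stmt-FinalStateConjecture-10166`),
companion of `…StubWeightedRatesNecessity` (closed form of `∂₀S(x)(u, u)` for a Schwarzschild
summand). Here:

* `abs_fderiv_summand_apply_self_ge` — `|D S(x)[e₀](u, u)| ≥ 2|M||⟪p̲, b̲⟫|/ρ² − 2|M|(1+3γ)‖ξ̇‖/ρ²`;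
* `exists_direction_norm_fderiv_summand_ge` — at lab distance `d ≥ 1` from the painted centre there
  is a direction (`p̲ ∥ b̲`, the body-frame 4-acceleration) in which
  `‖D S(x)[e₀]‖ ≥ 2|M|‖Λ̇e₀‖/((1+3γ)⁴ d) − 2|M|‖ξ̇‖/((1+3γ) d²)`: the kernel `M/d` is ATTAINED;
The companion `…StubWeightedRatesNecessityQS` concludes: for ONE Schwarzschild hole, the
quasi-stationarity clause QS of the line implies the weighted 4-velocity rate `t^{3/4}‖(Λe₀)˙‖ → 0`,
so RATES_E0 (the dynamical input of `stub_quasiStationarity_of_weightedRates_e0`) is also NECESSARY.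
-/

set_option linter.dupNamespace false

noncomputable section

namespace Summit.FinalStateConjecture.FinalStateConjecture.Theorems.SublinearIsFree.WeightedRates

open scoped BigOperators Topology ContDiff InnerProductSpace ENNReal
open Filter Set Function Literature.Geometry.Lorentzian
open Summit.FinalStateConjecture.FinalStateConjecture.Theorems
open Summit.FinalStateConjecture.FinalStateConjecture.Theorems.InertialRecession.Negative
open Summit.FinalStateConjecture.FinalStateConjecture.Theorems.SublinearIsFree.QuasiStationarity

/-! ### The lower bound on the pair `(u, u)` -/

-- operator-norm instance paths on form-valued maps are slow to unify
set_option synthInstance.maxHeartbeats 200000 in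
/-- **Lower bound for `|∂₀S(x)(u, u)|`** (Schwarzschild summand, notation of
`fderiv_summand_apply_self_eq`, Lorentz factor `|(Λ(t)e₀)⁰| ≤ γ`):
`|D S(x)[e₀](u, u)| ≥ 2|M| |⟪p̲, b̲⟫|/ρ² − 2|M|(1 + 3γ)‖ξ̇(t)‖/ρ²`. The rotation part of the body rate
is invisible along `p̲` (`inner_spatial_bodyRate_apply`), the boost part enters with the factor
`2 − p⁰/ρ ≥ 1` (`|p⁰| ≤ ρ`, `abs_apply_zero_le_spatialNorm_restPosition`). [cite: KerrSchild1965, §2] -/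
theorem abs_fderiv_summand_apply_self_ge (M γ : ℝ) {Λ : ℝ → lorentzGroup} {ξ : ℝ → E3} {t : ℝ}
    (hΛ : ContDiff ℝ 1 (fun s ↦ ((Λ s : E4 ≃L[ℝ] E4) : E4 →L[ℝ] E4))) (hξ : ContDiff ℝ 1 ξ)
    (hγ : |((Λ t : E4 ≃L[ℝ] E4) (E4.basisVector 0)) 0| ≤ γ)
    {x : E4} (hx : x 0 = t) (hd : 1 ≤ ‖E4.spatial x - ξ t‖) :
    2 * |M| * |⟪E4.spatial ((((Λ t : E4 ≃L[ℝ] E4).symm : E4 →L[ℝ] E4))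
          (E4.spaceEmbed (E4.spatial x - ξ t))),
        E4.spatial ((((Λ t : E4 ≃L[ℝ] E4).symm : E4 →L[ℝ] E4))
          (deriv (fun s ↦ ((Λ s : E4 ≃L[ℝ] E4) : E4 →L[ℝ] E4)) t (E4.basisVector 0)))⟫_ℝ| /
        E4.spatialNorm ((((Λ t : E4 ≃L[ℝ] E4).symm : E4 →L[ℝ] E4))
          (E4.spaceEmbed (E4.spatial x - ξ t))) ^ 2 -
      2 * |M| * (1 + 3 * γ) * ‖deriv ξ t‖ /
        E4.spatialNorm ((((Λ t : E4 ≃L[ℝ] E4).symm : E4 →L[ℝ] E4))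
          (E4.spaceEmbed (E4.spatial x - ξ t))) ^ 2 ≤
    |fderiv ℝ (fun y : E4 ↦ boostedKerrBilin (Λ (y 0)) (E4.ofTimeSpace (y 0) (ξ (y 0))) M 0 y -
        Minkowski.bilin) x (E4.basisVector 0) ((Λ t : E4 ≃L[ℝ] E4) (E4.basisVector 0))
        ((Λ t : E4 ≃L[ℝ] E4) (E4.basisVector 0))| := by
  rw [fderiv_summand_apply_self_eq M hΛ hξ hx hd]
  set A : E4 →L[ℝ] E4 := (((Λ t : E4 ≃L[ℝ] E4).symm : E4 →L[ℝ] E4)) with hAdef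
  set L' : E4 →L[ℝ] E4 := deriv (fun s ↦ ((Λ s : E4 ≃L[ℝ] E4) : E4 →L[ℝ] E4)) t with hL'
  set p : E4 := A (E4.spaceEmbed (E4.spatial x - ξ t)) with hpdef
  set b : E4 := A (L' (E4.basisVector 0)) with hb
  set e : E4 := A (E4.spaceEmbed (-deriv ξ t)) with he
  set ρ : ℝ := E4.spatialNorm p with hρ
  set G : ℝ := 1 + 3 * γ with hG
  -- sizes
  have hγ1 : 1 ≤ γ := (one_le_abs_lorentz_apply_zero (Λ t)).trans hγ
  have hG0 : 0 ≤ G := by rw [hG]; linarith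
  have hAG : ‖A‖ ≤ G := (norm_lorentz_symm_le' (Λ t)).trans (by rw [hG]; linarith)
  have hρd : ‖E4.spatial x - ξ t‖ ≤ ρ := le_spatialNorm_restPosition (Λ t) _
  have hρ1 : 1 ≤ ρ := hd.trans hρd
  have hρ0 : 0 < ρ := one_pos.trans_le hρ1
  have hp0 : |p 0| ≤ ρ := abs_apply_zero_le_spatialNorm_restPosition (Λ t) _
  -- the antisymmetry: `⟪p̲, (AΛ̇p)̲⟫ = p⁰⟪p̲, b̲⟫`
  have hΛ' : HasDerivAt (fun s ↦ ((Λ s : E4 ≃L[ℝ] E4) : E4 →L[ℝ] E4)) L' t :=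
    (hΛ.differentiable one_ne_zero t).hasDerivAt
  have hW : ∀ v w, Minkowski.bilin ((A.comp L') v) w + Minkowski.bilin v ((A.comp L') w) = 0 :=
    fun v w ↦ by
    have h := minkowski_bodyRate_antisymm hΛ' v w
    simpa [hAdef] using h
  have hanti : ⟪E4.spatial p, E4.spatial (A (L' p))⟫_ℝ = p 0 * ⟪E4.spatial p, E4.spatial b⟫_ℝ :=
    inner_spatial_bodyRate_apply (A.comp L') hW p
  -- rewrite the value
  set I : ℝ := ⟪E4.spatial p, E4.spatial b⟫_ℝ with hI
  set J : ℝ := ⟪E4.spatial p, E4.spatial e⟫_ℝ with hJ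
  have hval : 2 * M * (-⟪E4.spatial p, E4.spatial (-(A (L' p)) + e)⟫_ℝ / ρ ^ 3 - 2 * I / ρ ^ 2) =
      2 * M * I * (p 0 / ρ - 2) / ρ ^ 2 - 2 * M * J / ρ ^ 3 := by
    rw [map_add, map_neg, inner_add_right, inner_neg_right, hanti]
    field_simp
    ring
  rw [hval]
  -- the error term
  have hJle : |J| ≤ ρ * (G * ‖deriv ξ t‖) := by
    refine (abs_real_inner_le_norm _ _).trans ?_
    refine mul_le_mul_of_nonneg_left ?_ (norm_nonneg _)
    refine (wr_norm_spatial_le e).trans ?_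
    refine (A.le_opNorm _).trans ?_
    rw [norm_spaceEmbed, norm_neg]
    exact mul_le_mul_of_nonneg_right hAG (norm_nonneg _)
  -- the main term has the factor `2 − p⁰/ρ ≥ 1`
  have hfac : 1 ≤ 2 - p 0 / ρ := by
    have h : p 0 / ρ ≤ 1 := by
      rw [div_le_one hρ0]; exact (le_abs_self _).trans hp0
    linarith
  have hmain : 2 * |M| * |I| / ρ ^ 2 ≤ |2 * M * I * (p 0 / ρ - 2) / ρ ^ 2| := by
    rw [abs_div, abs_mul, abs_mul, abs_mul, abs_of_pos (by positivity : (0 : ℝ) < ρ ^ 2),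
      show |p 0 / ρ - 2| = 2 - p 0 / ρ by
        rw [abs_sub_comm]; exact abs_of_pos (by linarith)]
    have h2 : |(2 : ℝ)| = 2 := abs_of_pos two_pos
    rw [h2]
    have hnum : 2 * |M| * |I| ≤ 2 * |M| * |I| * (2 - p 0 / ρ) := by
      have h0 : 0 ≤ 2 * |M| * |I| := by positivity
      nlinarith
    exact div_le_div_of_nonneg_right hnum (by positivity)
  have herr : |2 * M * J / ρ ^ 3| ≤ 2 * |M| * (1 + 3 * γ) * ‖deriv ξ t‖ / ρ ^ 2 := by
    rw [abs_div, abs_mul, abs_mul, abs_of_pos (by positivity : (0 : ℝ) < ρ ^ 3),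
      abs_of_pos (two_pos : (0 : ℝ) < 2), div_le_div_iff₀ (by positivity) (by positivity)]
    have h := mul_le_mul_of_nonneg_left hJle (by positivity : 0 ≤ 2 * |M|)
    rw [← hG]
    nlinarith [h, hρ0]
  have htri := abs_sub_abs_le_abs_sub (2 * M * I * (p 0 / ρ - 2) / ρ ^ 2) (2 * M * J / ρ ^ 3)
  linarith

/-! ### Alignment: the kernel `M/d` is attained -/

-- operator-norm instance paths on form-valued maps are slow to unify
set_option synthInstance.maxHeartbeats 200000 in
set_option maxHeartbeats 800000 in
/-- **The 4-velocity kernel `M/d` of `∂₀S` is attained.** For a Schwarzschild summand with `C¹`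
moduli, Lorentz factor `|(Λ(t)e₀)⁰| ≤ γ` and every lab distance `d ≥ 1` there is a spatial offset `w`,
`‖w‖ = d`, such that at the slab point `x = (t, ξ(t) + w)`:
`‖D S(x)[e₀]‖ ≥ 2|M|‖Λ̇(t)e₀‖/((1+3γ)⁴ d) − 2|M|‖ξ̇(t)‖/((1+3γ) d²)`. Choice: `w` with rest-frame
position `p̲ ∥ b̲`, the spatial body-frame 4-acceleration (`z ↦ (Λ⁻¹(0,z))̲` is injective, hence onto);
then `|⟪p̲, b̲⟫|/ρ² = ‖b̲‖/ρ ≥ ‖Λ̇e₀‖/((1+3γ)² d)`; finally `|F(u,u)| ≤ ‖F‖(1+3γ)²`. [cite: KerrSchild1965, §2] -/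
theorem exists_direction_norm_fderiv_summand_ge (M γ : ℝ) {Λ : ℝ → lorentzGroup} {ξ : ℝ → E3}
    {t : ℝ} (hΛ : ContDiff ℝ 1 (fun s ↦ ((Λ s : E4 ≃L[ℝ] E4) : E4 →L[ℝ] E4))) (hξ : ContDiff ℝ 1 ξ)
    (hγ : |((Λ t : E4 ≃L[ℝ] E4) (E4.basisVector 0)) 0| ≤ γ) {d : ℝ} (hd : 1 ≤ d) :
    ∃ w : E3, ‖w‖ = d ∧
      2 * |M| * ‖deriv (fun s ↦ ((Λ s : E4 ≃L[ℝ] E4) : E4 →L[ℝ] E4)) t (E4.basisVector 0)‖ /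
          ((1 + 3 * γ) ^ 4 * d) - 2 * |M| * ‖deriv ξ t‖ / ((1 + 3 * γ) * d ^ 2) ≤
        ‖fderiv ℝ (fun y : E4 ↦ boostedKerrBilin (Λ (y 0)) (E4.ofTimeSpace (y 0) (ξ (y 0))) M 0 y -
          Minkowski.bilin) (E4.ofTimeSpace t (ξ t + w)) (E4.basisVector 0)‖ := by
  set A : E4 →L[ℝ] E4 := (((Λ t : E4 ≃L[ℝ] E4).symm : E4 →L[ℝ] E4)) with hAdef
  set L' : E4 →L[ℝ] E4 := deriv (fun s ↦ ((Λ s : E4 ≃L[ℝ] E4) : E4 →L[ℝ] E4)) t with hL'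
  set b : E4 := A (L' (E4.basisVector 0)) with hb
  set u : E4 := (Λ t : E4 ≃L[ℝ] E4) (E4.basisVector 0) with hu
  set G : ℝ := 1 + 3 * γ with hG
  set T : E3 →L[ℝ] E3 := E4.spatial.comp (A.comp E4.spaceEmbed) with hT
  -- sizes
  have hγ1 : 1 ≤ γ := (one_le_abs_lorentz_apply_zero (Λ t)).trans hγ
  have hG1 : 1 ≤ G := by rw [hG]; linarith
  have hG0 : 0 < G := one_pos.trans_le hG1
  have hAG : ‖A‖ ≤ G := (norm_lorentz_symm_le' (Λ t)).trans (by rw [hG]; linarith)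
  have hΛG : ‖((Λ t : E4 ≃L[ℝ] E4) : E4 →L[ℝ] E4)‖ ≤ G :=
    (norm_lorentz_le (Λ t)).trans (by rw [hG]; linarith)
  have hd0 : 0 < d := one_pos.trans_le hd
  have huG : ‖u‖ ≤ G := by
    rw [hu]
    refine (((Λ t : E4 ≃L[ℝ] E4) : E4 →L[ℝ] E4).le_opNorm (E4.basisVector 0)).trans ?_
    have h1 : ‖(E4.basisVector 0 : E4)‖ = 1 := by simp
    rw [h1, mul_one]; exact hΛG
  -- `‖Λ̇e₀‖ ≤ G ‖b‖` and `b⁰ = 0`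
  have hΛ' : HasDerivAt (fun s ↦ ((Λ s : E4 ≃L[ℝ] E4) : E4 →L[ℝ] E4)) L' t :=
    (hΛ.differentiable one_ne_zero t).hasDerivAt
  have hW : ∀ v w, Minkowski.bilin ((A.comp L') v) w + Minkowski.bilin v ((A.comp L') w) = 0 :=
    fun v w ↦ by
    have h := minkowski_bodyRate_antisymm hΛ' v w
    simpa [hAdef] using h
  have hb0 : b 0 = 0 := by
    have h := bodyRate_apply_zero_zero (A.comp L') hW
    simpa [hb] using h
  have hLb : L' (E4.basisVector 0) = (Λ t : E4 ≃L[ℝ] E4) b := by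
    rw [hb, hAdef, ContinuousLinearEquiv.coe_coe, ContinuousLinearEquiv.apply_symm_apply]
  have hbn : ‖E4.spatial b‖ = ‖b‖ := (norm_eq_spatialNorm_of_apply_zero_eq_zero hb0).symm
  have hr : ‖L' (E4.basisVector 0)‖ ≤ G * ‖E4.spatial b‖ := by
    rw [hLb, hbn]
    exact (((Λ t : E4 ≃L[ℝ] E4) : E4 →L[ℝ] E4).le_opNorm b).trans
      (mul_le_mul_of_nonneg_right hΛG (norm_nonneg _))
  -- the generic step: from a slab point at lab offset `w`, `‖w‖ = d`
  have hstep : ∀ w : E3, ‖w‖ = d →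
      2 * |M| * |⟪E4.spatial (A (E4.spaceEmbed w)), E4.spatial b⟫_ℝ| /
          E4.spatialNorm (A (E4.spaceEmbed w)) ^ 2 - 2 * |M| * G * ‖deriv ξ t‖ / d ^ 2 ≤
        G ^ 2 * ‖fderiv ℝ (fun y : E4 ↦ boostedKerrBilin (Λ (y 0))
          (E4.ofTimeSpace (y 0) (ξ (y 0))) M 0 y - Minkowski.bilin) (E4.ofTimeSpace t (ξ t + w))
          (E4.basisVector 0)‖ := by
    intro w hw
    have hx : (E4.ofTimeSpace t (ξ t + w)) 0 = t := by simp
    have hsw : E4.spatial (E4.ofTimeSpace t (ξ t + w)) - ξ t = w := by simp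
    have hd' : 1 ≤ ‖E4.spatial (E4.ofTimeSpace t (ξ t + w)) - ξ t‖ := by rw [hsw, hw]; exact hd
    have key := abs_fderiv_summand_apply_self_ge M γ hΛ hξ hγ hx hd'
    rw [hsw] at key
    have hρ : d ≤ E4.spatialNorm (A (E4.spaceEmbed w)) := by
      rw [← hw]; exact le_spatialNorm_restPosition (Λ t) w
    have hρ0 : 0 < E4.spatialNorm (A (E4.spaceEmbed w)) := hd0.trans_le hρ
    have herr : 2 * |M| * (1 + 3 * γ) * ‖deriv ξ t‖ / E4.spatialNorm (A (E4.spaceEmbed w)) ^ 2 ≤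
        2 * |M| * G * ‖deriv ξ t‖ / d ^ 2 := by
      rw [← hG]
      exact div_le_div_of_nonneg_left (by positivity) (by positivity) (pow_le_pow_left₀ hd0.le hρ 2)
    have hop := (fderiv ℝ (fun y : E4 ↦ boostedKerrBilin (Λ (y 0))
      (E4.ofTimeSpace (y 0) (ξ (y 0))) M 0 y - Minkowski.bilin) (E4.ofTimeSpace t (ξ t + w))
      (E4.basisVector 0)).le_opNorm₂ u u
    rw [Real.norm_eq_abs] at hop
    have huu : ‖fderiv ℝ (fun y : E4 ↦ boostedKerrBilin (Λ (y 0))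
        (E4.ofTimeSpace (y 0) (ξ (y 0))) M 0 y - Minkowski.bilin) (E4.ofTimeSpace t (ξ t + w))
        (E4.basisVector 0)‖ * ‖u‖ * ‖u‖ ≤ G ^ 2 * ‖fderiv ℝ (fun y : E4 ↦ boostedKerrBilin (Λ (y 0))
        (E4.ofTimeSpace (y 0) (ξ (y 0))) M 0 y - Minkowski.bilin) (E4.ofTimeSpace t (ξ t + w))
        (E4.basisVector 0)‖ := by
      have hF := norm_nonneg (fderiv ℝ (fun y : E4 ↦ boostedKerrBilin (Λ (y 0))
        (E4.ofTimeSpace (y 0) (ξ (y 0))) M 0 y - Minkowski.bilin) (E4.ofTimeSpace t (ξ t + w))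
        (E4.basisVector 0))
      have h1 : ‖u‖ * ‖u‖ ≤ G * G := mul_le_mul huG huG (norm_nonneg _) hG0.le
      nlinarith
    linarith
  -- choice of the direction
  by_cases hbz : E4.spatial b = 0
  · -- no 4-acceleration: any direction works
    obtain ⟨w, hw⟩ : ∃ w : E3, ‖w‖ = d := ⟨d • EuclideanSpace.single 0 1, by
      rw [norm_smul, Real.norm_eq_abs, abs_of_pos hd0]; simp⟩
    refine ⟨w, hw, ?_⟩
    have h0 : ‖L' (E4.basisVector 0)‖ = 0 := by
      have h := hr; rw [hbz, norm_zero, mul_zero] at h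
      exact le_antisymm h (norm_nonneg _)
    rw [h0, mul_zero, zero_div, zero_sub]
    have : 0 ≤ 2 * |M| * ‖deriv ξ t‖ / ((1 + 3 * γ) * d ^ 2) := by rw [← hG]; positivity
    linarith [norm_nonneg (fderiv ℝ (fun y : E4 ↦ boostedKerrBilin (Λ (y 0))
      (E4.ofTimeSpace (y 0) (ξ (y 0))) M 0 y - Minkowski.bilin) (E4.ofTimeSpace t (ξ t + w))
      (E4.basisVector 0))]
  · -- align the rest-frame position with the spatial 4-acceleration
    have hTinj : Function.Injective T.toLinearMap := by
      intro w w' hww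
      have h : T (w - w') = 0 := by rw [map_sub]; exact sub_eq_zero.mpr hww
      have hle : ‖w - w'‖ ≤ ‖T (w - w')‖ := le_spatialNorm_restPosition (Λ t) _
      rw [h, norm_zero] at hle
      exact sub_eq_zero.mp (norm_le_zero_iff.mp hle)
    obtain ⟨w₀, hw₀⟩ := (LinearMap.injective_iff_surjective.mp hTinj) (E4.spatial b)
    have hTw₀ : T w₀ = E4.spatial b := hw₀
    have hw₀0 : w₀ ≠ 0 := by
      intro h; rw [h, map_zero] at hTw₀; exact hbz hTw₀.symm
    have hn0 : 0 < ‖w₀‖ := norm_pos_iff.mpr hw₀0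
    set w : E3 := (d / ‖w₀‖) • w₀ with hwdef
    have hw : ‖w‖ = d := by
      rw [hwdef, norm_smul, Real.norm_eq_abs, abs_of_pos (div_pos hd0 hn0), div_mul_cancel₀ _ hn0.ne']
    refine ⟨w, hw, ?_⟩
    have hTw : E4.spatial (A (E4.spaceEmbed w)) = (d / ‖w₀‖) • E4.spatial b := by
      have h : T w = (d / ‖w₀‖) • T w₀ := by rw [hwdef, map_smul]
      rw [hTw₀] at h
      exact h
    set β : ℝ := ‖E4.spatial b‖ with hβ
    have hβ0 : 0 < β := norm_pos_iff.mpr hbz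
    have hinner : ⟪E4.spatial (A (E4.spaceEmbed w)), E4.spatial b⟫_ℝ = (d / ‖w₀‖) * β ^ 2 := by
      rw [hTw, inner_smul_left, real_inner_self_eq_norm_sq, ← hβ]; simp
    have hρeq : E4.spatialNorm (A (E4.spaceEmbed w)) = (d / ‖w₀‖) * β := by
      rw [E4.spatialNorm, hTw, norm_smul, Real.norm_eq_abs, abs_of_pos (div_pos hd0 hn0)]
    have hρG : E4.spatialNorm (A (E4.spaceEmbed w)) ≤ G * d := by
      refine (wr_norm_spatial_le _).trans ?_
      refine (A.le_opNorm _).trans ?_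
      rw [norm_spaceEmbed, hw]
      exact mul_le_mul_of_nonneg_right hAG hd0.le
    have hmain : 2 * |M| * ‖L' (E4.basisVector 0)‖ / (G ^ 2 * d) ≤
        2 * |M| * |⟪E4.spatial (A (E4.spaceEmbed w)), E4.spatial b⟫_ℝ| /
          E4.spatialNorm (A (E4.spaceEmbed w)) ^ 2 := by
      have hlam : 0 < d / ‖w₀‖ := div_pos hd0 hn0
      rw [hinner, hρeq, abs_of_pos (mul_pos hlam (pow_pos hβ0 2))]
      have e1 : 2 * |M| * (d / ‖w₀‖ * β ^ 2) / (d / ‖w₀‖ * β) ^ 2 = 2 * |M| * β / (d / ‖w₀‖ * β) := by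
        field_simp
      rw [e1, div_le_div_iff₀ (by positivity) (by positivity)]
      have h1 : ‖L' (E4.basisVector 0)‖ * (d / ‖w₀‖ * β) ≤ (G * β) * (G * d) := by
        rw [← hρeq]
        exact mul_le_mul hr hρG (E4.spatialNorm_nonneg _) (by positivity)
      nlinarith [h1, abs_nonneg M]
    have h := hstep w hw
    have hfin : 2 * |M| * ‖L' (E4.basisVector 0)‖ / ((1 + 3 * γ) ^ 4 * d) -
        2 * |M| * ‖deriv ξ t‖ / ((1 + 3 * γ) * d ^ 2) =
        (2 * |M| * ‖L' (E4.basisVector 0)‖ / (G ^ 2 * d) - 2 * |M| * G * ‖deriv ξ t‖ / d ^ 2) / G ^ 2 := by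
      rw [← hG]; field_simp
    rw [hfin, div_le_iff₀ (by positivity)]
    linarith

-- operator-norm instance paths on form-valued maps are slow to unify
set_option synthInstance.maxHeartbeats 200000 in
/-- **Registered sub-goal form** (worker carrier `wr_velocityKernel_attained` of the crux item) of
`exists_direction_norm_fderiv_summand_ge`: the 4-velocity kernel `M/d` of `∂₀S` is attained
(Kerr–Schild 1965, §2). [cite: KerrSchild1965, §2] -/
theorem wr_velocityKernel_attained : open Literature.Geometry.Lorentzian in ∀ (M γ : ℝ) {Λ : ℝ → lorentzGroup} {ξ : ℝ → E3} {t : ℝ}, ContDiff ℝ 1 (fun s ↦ ((Λ s : E4 ≃L[ℝ] E4) : E4 →L[ℝ] E4)) → ContDiff ℝ 1 ξ → |((Λ t : E4 ≃L[ℝ] E4) (E4.basisVector 0)) 0| ≤ γ → ∀ {d : ℝ}, 1 ≤ d → ∃ w : E3, ‖w‖ = d ∧ 2 * |M| * ‖deriv (fun s ↦ ((Λ s : E4 ≃L[ℝ] E4) : E4 →L[ℝ] E4)) t (E4.basisVector 0)‖ / ((1 + 3 * γ) ^ 4 * d) - 2 * |M| * ‖deriv ξ t‖ / ((1 + 3 *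 γ) * d ^ 2) ≤ ‖fderiv ℝ (fun y : E4 ↦ boostedKerrBilin (Λ (y 0)) (E4.ofTimeSpace (y 0) (ξ (y 0))) M 0 y - Minkowski.bilin) (E4.ofTimeSpace t (ξ t + w)) (E4.basisVector 0)‖ :=
  fun M γ _ _ _ hΛ hξ hγ _ hd ↦ exists_direction_norm_fderiv_summand_ge M γ hΛ hξ hγ hd

end Summit.FinalStateConjecture.FinalStateConjecture.Theorems.SublinearIsFree.WeightedRates

end
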